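import Summits.Ventures.QEC.CircuitDistance.PortK2DataBB144Z
import Summits.Ventures.QEC.CircuitDistance.K2Chunks
import HarnessLib

/-!
# K2(`[[144,12,12]]`) chunk module — COMPUTATIONAL (native_decide; `Lean.ofReduceBool`)

Cell `qec`, CDX, R146/R152 STEP 1 («computational» header; `ofReduceBool` confined to these chunk modules). Checker of record
`K2.K2Data` (qec-cdx-type-1, PortK2Check); data module of record `PortK2DataBB144X/Z` (p669158/9, crit-1 data audit PASS
2026-08-28T21:20Z); chunk glue `K2Chunks` (idea-1 g2). Cube 0, child 19: leaf group 5 of 6.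
Leaf theorems: the K2 DFS accepts below one descendant state of pivot cube 0 (sector Z); sizes are exact DFS visit counts
(eng-1 g2 `k2count.c`), capped so that the gate's native-axiom audit re-verifies every leaf in place. Assemblies re-derive the
child lists in the kernel (`decide`) and end in the literal cube fact `d144Z.cube (Ts144Z.getD 0 []) (0) (lives144Z.getD 0 0) = true`
(the `hcubes` hypothesis of `K2Inst.k2_complete`). Emitted by qec-cdx-eng-1 g2 (`gen2.py`, idea-1's `gen_k2chunks_from_lean.py` lineage).
-/

namespace Summit.Ventures.QEC.CircuitDistance.K2

set_option maxRecDepth 100000 in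
set_option maxHeartbeats 0 in
set_option exponentiation.threshold 1024 in
/-- K2(144) chunk fact `cube144Z0_ch19_14` (452401 DFS visits; see the module docstring). -/
theorem cube144Z0_ch19_14 : app5 (d144Z.dfs (Ts144Z.getD 0 []) 6) (2361201255834576781312, 492, 8543948143683640329580143363784281366709364754946634853180672910773578922929222091490289711579137, 3, 2348542582765289276688253699012386770518345275267729596841742814283101030831486145697418563746506595446554588) = true := by native_decide

set_option maxRecDepth 100000 in
set_option maxHeartbeats 0 in
set_option exponentiation.threshold 1024 in
/-- K2(144) chunk fact `cube144Z0_ch19_15` (512650 DFS visits; see the module docstring). -/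
theorem cube144Z0_ch19_15 : app5 (d144Z.dfs (Ts144Z.getD 0 []) 6) (18014401733855232, 2536, 8543948143683640329583705327466874589517804682708132576908581118309680170748795249592095633047553, 3, 2348542582765289276688253699012383152015556609136622610248461292785980616144465344429792330697006348161253340) = true := by native_decide

set_option maxRecDepth 100000 in
set_option maxHeartbeats 0 in
set_option exponentiation.threshold 1024 in
/-- K2(144) chunk fact `cube144Z0_ch19_16` (436014 DFS visits; see the module docstring). -/
theorem cube144Z0_ch19_16 : app5 (d144Z.dfs (Ts144Z.getD 0 []) 6) (297471797772657098752, 1888, 8543948147662226220858379961921266443585384810230260286166948170812590718267838176192115352010753, 3, 2348542582765289276684275113121104858878313551151448043527657643579601834404941632614647054720906081156988892) = true := by native_decide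

set_option maxRecDepth 100000 in
set_option maxHeartbeats 0 in
set_option exponentiation.threshold 1024 in
/-- K2(144) chunk fact `cube144Z0_ch19_17` (414737 DFS visits; see the module docstring). -/
theorem cube144Z0_ch19_17 : app5 (d144Z.dfs (Ts144Z.getD 0 []) 6) (1180609916592106504448, 504, 8543948175512327459806431922622672339807351855855804730818420347478573424284770008893984381861889, 3, 2348542582765289276652446425990878513780369087270051509761228449928571580488751938093484846912103945122873308) = true := by native_decide
end Summit.Ventures.QEC.CircuitDistance.K2
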